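import Mathlib
import HarnessLib

/-!
# Two-code FINITE-SAMPLE agreement from each code's own tail certificate: on the product of the
# two runs, `P(|Â − B̂| ≥ ε) ≤ P_A(|Â − a| ≥ ε/2) + P_B(|B̂ − a| ≥ ε/2)` (and the version with two
# targets `a_A, a_B`, `|a_A − a_B| ≤ δ`)

HONEST FRAMING: exact (Metropolis-corrected) sampling algorithms for lattice gauge theory;
figures of merit are autocorrelation/cost numbers at stated couplings and volumes; no
continuum-physics claim.

Venture `LatticeQCDFlow` (cell pub-lqcd), topic `Scoring`; FANOUT row 4 (`s0-u1-b`, rung S0-B).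
The asymptotic two-code theorems of the packet (`Scoring/TwoCodeAgreement*`,
`Scoring/AsymptoticCoverage`) calibrate the criterion "within `z` combined error bars"; the
FINITE-SAMPLE sentence "acceptance of A and B within `ε` (e.g. 3 pp)" needs no limit theorem at
all: whatever one-code tail certificate each code carries for its own printed number — the
Doeblin-chain Hoeffding inequality of `Scoring/ChainHoeffding` (dependent updates, any start),
an iid Hoeffding or Chebyshev bound, the reweighting bands of `Scoring/ReweightedEDF*` — the two
certificates add up on the product of the two (independent or not: only the product MEASURE of
the two runs is used, through its marginals) by the triangle inequality and a union bound.  This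
file states that glue once, for arbitrary real statistics `Â` on `(Ω_A, P_A)` and `B̂` on
`(Ω_B, P_B)`: **`measureReal_prod_abs_sub_ge_le`** (common target `a`) and
**`measureReal_prod_abs_sub_ge_le_of_targets`** (targets `a_A`, `a_B` with `|a_A − a_B| ≤ δ`:
thresholds `(ε − δ)/2`).  No measurability is needed (outer measures; Mathlib's `prod_prod` is
measurability-free).  NEW WORK of the cell (elementary; our formalisation); no definition;
nothing cited as a fact.

## Content

* `measureReal_prod_fst_le`, `measureReal_prod_snd_le` — marginal events on the product;
* **`measureReal_prod_abs_sub_ge_le`**, **`measureReal_prod_abs_sub_ge_le_of_targets`**.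

NOT CLAIMED: which certificate a code uses; anything sharper than the union bound.
-/

noncomputable section

namespace Summit.Ventures.LatticeQCDFlow.Scoring.CardConsistency

open MeasureTheory Set

variable {ΩA : Type*} [MeasurableSpace ΩA] {PA : Measure ΩA} [IsProbabilityMeasure PA]
variable {ΩB : Type*} [MeasurableSpace ΩB] {PB : Measure ΩB} [IsProbabilityMeasure PB]

omit [IsProbabilityMeasure PA] in
/-- `(P_A ⊗ P_B)(E × Ω_B) = P_A(E)` in real form (any set `E`). [folklore] -/
theorem measureReal_prod_fst_eq (E : Set ΩA) : (PA.prod PB).real (E ×ˢ (univ : Set ΩB)) = PA.real E := by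
  rw [measureReal_def, measureReal_def, Measure.prod_prod, measure_univ, mul_one]

/-- `(P_A ⊗ P_B)(Ω_A × F) = P_B(F)` in real form (any set `F`). [folklore] -/
theorem measureReal_prod_snd_eq (F : Set ΩB) : (PA.prod PB).real ((univ : Set ΩA) ×ˢ F) = PB.real F := by
  rw [measureReal_def, measureReal_def, Measure.prod_prod, measure_univ, one_mul]

/-- **TWO-CODE AGREEMENT FROM ONE-CODE TAILS (common target).**  Real statistics `Â` on
`(Ω_A, P_A)`, `B̂` on `(Ω_B, P_B)`, a target `a`, `ε` real:
`(P_A ⊗ P_B)(ε ≤ |Â − B̂|) ≤ P_A(ε/2 ≤ |Â − a|) + P_B(ε/2 ≤ |B̂ − a|)`. [ours] -/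
theorem measureReal_prod_abs_sub_ge_le (f : ΩA → ℝ) (g : ΩB → ℝ) (a ε : ℝ) :
    (PA.prod PB).real {ω : ΩA × ΩB | ε ≤ |f ω.1 - g ω.2|}
      ≤ PA.real {x | ε / 2 ≤ |f x - a|} + PB.real {y | ε / 2 ≤ |g y - a|} := by
  have hsub : {ω : ΩA × ΩB | ε ≤ |f ω.1 - g ω.2|}
      ⊆ ({x | ε / 2 ≤ |f x - a|} ×ˢ (univ : Set ΩB)) ∪ ((univ : Set ΩA) ×ˢ {y | ε / 2 ≤ |g y - a|}) := by
    intro ω hω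
    simp only [mem_setOf_eq, mem_union, mem_prod, mem_univ, and_true, true_and] at hω ⊢
    by_contra hcon
    push Not at hcon
    have h1 : |f ω.1 - a| < ε / 2 := hcon.1
    have h2 : |g ω.2 - a| < ε / 2 := hcon.2
    have h3 : |f ω.1 - g ω.2| < ε := by
      calc |f ω.1 - g ω.2| = |(f ω.1 - a) - (g ω.2 - a)| := by ring_nf
        _ ≤ |f ω.1 - a| + |g ω.2 - a| := abs_sub _ _
        _ < ε := by linarith
    linarith
  calc (PA.prod PB).real {ω : ΩA × ΩB | ε ≤ |f ω.1 - g ω.2|}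
      ≤ (PA.prod PB).real (({x | ε / 2 ≤ |f x - a|} ×ˢ (univ : Set ΩB))
          ∪ ((univ : Set ΩA) ×ˢ {y | ε / 2 ≤ |g y - a|})) :=
        measureReal_mono hsub (measure_ne_top _ _)
    _ ≤ (PA.prod PB).real ({x | ε / 2 ≤ |f x - a|} ×ˢ (univ : Set ΩB))
          + (PA.prod PB).real ((univ : Set ΩA) ×ˢ {y | ε / 2 ≤ |g y - a|}) :=
        measureReal_union_le _ _
    _ = PA.real {x | ε / 2 ≤ |f x - a|} + PB.real {y | ε / 2 ≤ |g y - a|} := by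
        rw [measureReal_prod_fst_eq, measureReal_prod_snd_eq]

/-- **TWO-CODE AGREEMENT FROM ONE-CODE TAILS (two targets).**  If the two codes' statistics
concentrate around `a_A` and `a_B` with `|a_A − a_B| ≤ δ`, then
`(P_A ⊗ P_B)(ε ≤ |Â − B̂|) ≤ P_A((ε − δ)/2 ≤ |Â − a_A|) + P_B((ε − δ)/2 ≤ |B̂ − a_B|)`. [ours] -/
theorem measureReal_prod_abs_sub_ge_le_of_targets (f : ΩA → ℝ) (g : ΩB → ℝ) {aA aB δ : ℝ}
    (hab : |aA - aB| ≤ δ) (ε : ℝ) :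
    (PA.prod PB).real {ω : ΩA × ΩB | ε ≤ |f ω.1 - g ω.2|}
      ≤ PA.real {x | (ε - δ) / 2 ≤ |f x - aA|} + PB.real {y | (ε - δ) / 2 ≤ |g y - aB|} := by
  have hsub : {ω : ΩA × ΩB | ε ≤ |f ω.1 - g ω.2|}
      ⊆ ({x | (ε - δ) / 2 ≤ |f x - aA|} ×ˢ (univ : Set ΩB))
        ∪ ((univ : Set ΩA) ×ˢ {y | (ε - δ) / 2 ≤ |g y - aB|}) := by
    intro ω hω
    simp only [mem_setOf_eq, mem_union, mem_prod, mem_univ, and_true, true_and] at hω ⊢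
    by_contra hcon
    push Not at hcon
    have h1 : |f ω.1 - aA| < (ε - δ) / 2 := hcon.1
    have h2 : |g ω.2 - aB| < (ε - δ) / 2 := hcon.2
    have h3 : |f ω.1 - g ω.2| < ε := by
      calc |f ω.1 - g ω.2| = |(f ω.1 - aA) + (aA - aB) - (g ω.2 - aB)| := by ring_nf
        _ ≤ |(f ω.1 - aA) + (aA - aB)| + |g ω.2 - aB| := abs_sub _ _
        _ ≤ |f ω.1 - aA| + |aA - aB| + |g ω.2 - aB| := by linarith [abs_add_le (f ω.1 - aA) (aA - aB)]
        _ < ε := by linarith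
    linarith
  calc (PA.prod PB).real {ω : ΩA × ΩB | ε ≤ |f ω.1 - g ω.2|}
      ≤ (PA.prod PB).real (({x | (ε - δ) / 2 ≤ |f x - aA|} ×ˢ (univ : Set ΩB))
          ∪ ((univ : Set ΩA) ×ˢ {y | (ε - δ) / 2 ≤ |g y - aB|})) :=
        measureReal_mono hsub (measure_ne_top _ _)
    _ ≤ (PA.prod PB).real ({x | (ε - δ) / 2 ≤ |f x - aA|} ×ˢ (univ : Set ΩB))
          + (PA.prod PB).real ((univ : Set ΩA) ×ˢ {y | (ε - δ) / 2 ≤ |g y - aB|}) :=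
        measureReal_union_le _ _
    _ = PA.real {x | (ε - δ) / 2 ≤ |f x - aA|} + PB.real {y | (ε - δ) / 2 ≤ |g y - aB|} := by
        rw [measureReal_prod_fst_eq, measureReal_prod_snd_eq]

end Summit.Ventures.LatticeQCDFlow.Scoring.CardConsistency

end
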